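import Mathlib.MeasureTheory.Integral.Marginal
import Mathlib.MeasureTheory.Integral.Pi
import Literature.Probability.LatticeModels.MarkovWindowDensity
import HarnessLib

/-!
# Two-sided peeling of nearest-neighbour Boltzmann weights on windows of `ℤ` (transfer-operator
# form of finite-volume integrals)

Topic `Literature/Probability/LatticeModels`; theorems only (no definitions, no named facts).
Companion of `MarkovWindowDensity.lean` (same data: a measurable kernel `k : S → S → ℝ≥0∞`, a
one-site weight `w : S → ℝ≥0∞`, a σ-finite a priori measure `ν` on `S`; all finite-dimensional
integrals are Mathlib marginal integrals `∫⋯∫⁻_s, f ∂ν` on `ℤ → S`).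

For a window `{a, …, a+n}` the UN-NORMALISED nearest-neighbour weight WITHOUT boundary bonds is
`B a n σ = ∏_{j<n} k(σ_{a+j}, σ_{a+j+1}) ∏_{j≤n} w(σ_{a+j})`; the one-site transfer operator is
`(T f)(z) = ∫ k(z, y) f(y) w(y) dν(y)`. Both are VARIABLES constrained by hypotheses `hB`, `hT`
(instantiate with the lambdas and `fun _ _ _ => rfl`, `fun _ _ => rfl`), so that no definition is
introduced. Main results (Georgii 2011, §10–11: one-dimensional nearest-neighbour specifications
are governed by the transfer operator; Cassandro–Olivieri–Pellegrinotti–Presutti 1978, §2–3 for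
unbounded spins):

* `lmarginal_Icc_peel_iterate` — **two-sided peeling**: for an observable `Φ` read on the window
  `W = {a, …, a+m}`, symmetric `k`, measurable `f, g` and every `i`,
  `∫⋯∫⁻_{a-i,…,a+m+i} Φ · B (a-i) (m+2i) · f(σ_{a-i}) · g(σ_{a+m+i})
     = ∫⋯∫⁻_W Φ · B a m · (T^i f)(σ_a) · (T^i g)(σ_{a+m})`
  (integrate the two outermost sites first; each step applies `T` once on each side);
* `lmarginal_Icc_pad_one` — the padded window `{a-1, …, a+m+1}` as a double integral over the two
  extra spins against the "matrix element" `∫⋯∫⁻_W Φ · B a m · k(y, σ_a) · k(σ_{a+m}, y')`;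
* bookkeeping: `measurable_B`, `dependsOn_B`, `B_pad_one`, `measurable_T`, `measurable_iterate_T`,
  `lmarginal_congr_of_forall_updateFinset`, `lmarginal_mul_const_right`, `lintegral_lintegral_pad`.

[cite: Georgii2011, Thm 10.25 and §11.1]
-/

noncomputable section

open MeasureTheory Set Function Finset
open scoped ENNReal

namespace Literature.Probability.LatticeModels

variable {S : Type*} [MeasurableSpace S] {ν : Measure S}

/-- Two integrands agreeing on the fibre `{updateFinset x s ζ}` have the same marginal integral over
`s` at `x`. [folklore] -/
theorem lmarginal_congr_of_forall_updateFinset {f g : (ℤ → S) → ℝ≥0∞} (s : Finset ℤ) (x : ℤ → S)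
    (h : ∀ ζ : ↥s → S, f (updateFinset x s ζ) = g (updateFinset x s ζ)) :
    (∫⋯∫⁻_s, f ∂fun _ : ℤ => ν) x = (∫⋯∫⁻_s, g ∂fun _ : ℤ => ν) x := by
  unfold lmarginal
  exact lintegral_congr h

/-- Marginal integrals commute with multiplication by a constant on the right. [folklore] -/
theorem lmarginal_mul_const_right (s : Finset ℤ) {f : (ℤ → S) → ℝ≥0∞} (hf : Measurable f)
    (c : ℝ≥0∞) (x : ℤ → S) :
    (∫⋯∫⁻_s, (fun σ => f σ * c) ∂fun _ : ℤ => ν) x = (∫⋯∫⁻_s, f ∂fun _ : ℤ => ν) x * c := by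
  unfold lmarginal
  exact lintegral_mul_const c (hf.comp measurable_updateFinset)

section Peel

variable {k : S → S → ℝ≥0∞} {w : S → ℝ≥0∞} {B : ℤ → ℕ → (ℤ → S) → ℝ≥0∞}
  {T : (S → ℝ≥0∞) → (S → ℝ≥0∞)}

/-- **Measurability of the un-normalised window weights.** [folklore] -/
theorem measurable_B (hk : Measurable (uncurry k)) (hw : Measurable w)
    (hB : ∀ a n σ, B a n σ = (∏ j ∈ Finset.range n, k (σ (a + j)) (σ (a + j + 1))) *
      ∏ j ∈ Finset.range (n + 1), w (σ (a + j)))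
    (a : ℤ) (n : ℕ) : Measurable (B a n) := by
  have h : B a n = fun σ => (∏ j ∈ Finset.range n, k (σ (a + j)) (σ (a + j + 1))) *
      ∏ j ∈ Finset.range (n + 1), w (σ (a + j)) := funext (hB a n)
  rw [h]
  exact (Finset.measurable_prod _ fun j _ => measurable_kernel_eval hk _ _).mul
    (Finset.measurable_prod _ fun j _ => measurable_comp_eval hw _)

omit [MeasurableSpace S] in
/-- **The window weight depends only on the window** `{a, …, a+n}`. [folklore] -/
theorem dependsOn_B
    (hB : ∀ a n σ, B a n σ = (∏ j ∈ Finset.range n, k (σ (a + j)) (σ (a + j + 1))) *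
      ∏ j ∈ Finset.range (n + 1), w (σ (a + j)))
    (a : ℤ) (n : ℕ) : DependsOn (B a n) (↑(Finset.Icc a (a + n)) : Set ℤ) := by
  intro x y hxy
  simp only [Finset.coe_Icc, Set.mem_Icc] at hxy
  rw [hB, hB]
  congr 1
  · refine Finset.prod_congr rfl fun j hj => ?_
    rw [Finset.mem_range] at hj
    rw [hxy (a + j) ⟨by omega, by omega⟩, hxy (a + j + 1) ⟨by omega, by omega⟩]
  · refine Finset.prod_congr rfl fun j hj => ?_
    rw [Finset.mem_range] at hj
    rw [hxy (a + j) ⟨by omega, by omega⟩]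

omit [MeasurableSpace S] in
/-- **Padding the window by one site on each side**:
`B (c-1) (n+2) σ = w(σ_{c-1}) k(σ_{c-1}, σ_c) · B c n σ · k(σ_{c+n}, σ_{c+n+1}) w(σ_{c+n+1})`.
[folklore] -/
theorem B_pad_one
    (hB : ∀ a n σ, B a n σ = (∏ j ∈ Finset.range n, k (σ (a + j)) (σ (a + j + 1))) *
      ∏ j ∈ Finset.range (n + 1), w (σ (a + j)))
    (c : ℤ) (n : ℕ) (σ : ℤ → S) :
    B (c - 1) (n + 2) σ = w (σ (c - 1)) * k (σ (c - 1)) (σ c) * B c n σ *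
      (k (σ (c + n)) (σ (c + n + 1)) * w (σ (c + n + 1))) := by
  have i0 : c - 1 + ((0 : ℕ) : ℤ) = c - 1 := by simp
  have i1 : c - 1 + 1 = c := by ring
  have i2 : ∀ j : ℕ, c - 1 + ((j + 1 : ℕ) : ℤ) = c + j := by intro j; push_cast; ring
  have hk' : ∏ j ∈ Finset.range (n + 2), k (σ (c - 1 + j)) (σ (c - 1 + j + 1)) =
      k (σ (c - 1)) (σ c) * (∏ j ∈ Finset.range n, k (σ (c + j)) (σ (c + j + 1))) *
        k (σ (c + n)) (σ (c + n + 1)) := by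
    rw [Finset.prod_range_succ', Finset.prod_range_succ]
    simp only [i0, i1, i2]
    ring
  have hw' : ∏ j ∈ Finset.range (n + 2 + 1), w (σ (c - 1 + j)) =
      w (σ (c - 1)) * (∏ j ∈ Finset.range (n + 1), w (σ (c + j))) * w (σ (c + n + 1)) := by
    rw [Finset.prod_range_succ', Finset.prod_range_succ]
    simp only [i0, i2]
    push_cast
    ring
  rw [hB, hB, hk', hw']
  ring

/-- **Measurability of the one-site transfer operator** `(T f)(z) = ∫ k(z,y) f(y) w(y) dν(y)` on
measurable `f`. [folklore] -/
theorem measurable_T [SFinite ν] (hk : Measurable (uncurry k)) (hw : Measurable w)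
    (hT : ∀ f z, T f z = ∫⁻ y, k z y * f y * w y ∂ν) {f : S → ℝ≥0∞} (hf : Measurable f) :
    Measurable (T f) := by
  have h : T f = fun z => ∫⁻ y, k z y * f y * w y ∂ν := funext (hT f)
  rw [h]
  exact Measurable.lintegral_prod_right
    ((hk.mul (hf.comp measurable_snd)).mul (hw.comp measurable_snd))

/-- Measurability of the iterates `T^i f`. [folklore] -/
theorem measurable_iterate_T [SFinite ν] (hk : Measurable (uncurry k)) (hw : Measurable w)
    (hT : ∀ f z, T f z = ∫⁻ y, k z y * f y * w y ∂ν) {f : S → ℝ≥0∞} (hf : Measurable f) (i : ℕ) :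
    Measurable (T^[i] f) := by
  induction i with
  | zero => simpa using hf
  | succ i ih =>
    rw [Function.iterate_succ_apply']
    exact measurable_T hk hw hT ih

/-- **Integrating out one padding site on each side.** For `x : ℤ → S`, the padding sites
`p = c - 1`, `q = c + n + 1` of the window `{c, …, c+n}`, and an observable `Φ` read on the window,
the double integral over the spins at `p` and `q` of `Φ · B p (n+2) · f(σ_p) · g(σ_q)` is
`Φ(x) · B c n (x) · (T f)(x_c) · (T g)(x_{c+n})` (symmetric `k`). [folklore] -/
theorem lintegral_lintegral_pad [SFinite ν] (hk : Measurable (uncurry k)) (hw : Measurable w)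
    (hsym : ∀ z y, k z y = k y z)
    (hB : ∀ a n σ, B a n σ = (∏ j ∈ Finset.range n, k (σ (a + j)) (σ (a + j + 1))) *
      ∏ j ∈ Finset.range (n + 1), w (σ (a + j)))
    (hT : ∀ f z, T f z = ∫⁻ y, k z y * f y * w y ∂ν)
    {c : ℤ} {n : ℕ} {Φ : (ℤ → S) → ℝ≥0∞} (hΦd : DependsOn Φ (↑(Finset.Icc c (c + n)) : Set ℤ))
    {f g : S → ℝ≥0∞} (hf : Measurable f) (hg : Measurable g) {p q : ℤ} (hp : c - 1 = p)
    (hq : c + n + 1 = q) (x : ℤ → S) :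
    ∫⁻ y', ∫⁻ y, Φ (update (update x q y') p y) * B p (n + 2) (update (update x q y') p y) *
        f ((update (update x q y') p y) p) * g ((update (update x q y') p y) q) ∂ν ∂ν =
      Φ x * B c n x * (T f) (x c) * (T g) (x (c + n)) := by
  classical
  have hpq : q ≠ p := by omega
  -- values of the doubly updated configuration
  have hval : ∀ y y' : S, ∀ z : ℤ, z ≠ p → z ≠ q → update (update x q y') p y z = x z :=
    fun y y' z hzp hzq => by rw [update_of_ne hzp, update_of_ne hzq]
  have hΦ : ∀ y y', Φ (update (update x q y') p y) = Φ x := fun y y' =>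
    hΦd fun z hz => by
      simp only [Finset.coe_Icc, Set.mem_Icc] at hz
      exact hval y y' z (fun h => by omega) (fun h => by omega)
  have hBx : ∀ y y', B c n (update (update x q y') p y) = B c n x := fun y y' =>
    dependsOn_B hB c n fun z hz => by
      simp only [Finset.coe_Icc, Set.mem_Icc] at hz
      exact hval y y' z (fun h => by omega) (fun h => by omega)
  have hBp : ∀ σ : ℤ → S, B p (n + 2) σ =
      w (σ p) * k (σ p) (σ c) * B c n σ * (k (σ (c + n)) (σ q) * w (σ q)) := by
    intro σ
    have h := B_pad_one hB c n σ
    rw [hp, hq] at h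
    exact h
  have hint : ∀ y y', Φ (update (update x q y') p y) * B p (n + 2) (update (update x q y') p y) *
      f ((update (update x q y') p y) p) * g ((update (update x q y') p y) q) =
      Φ x * B c n x * (k (x (c + n)) y' * w y' * g y') * (k (x c) y * f y * w y) := by
    intro y y'
    rw [hBp, hΦ, hBx, hval _ _ c (by omega) (by omega), hval _ _ (c + n) (by omega) (by omega)]
    simp only [update_self, update_of_ne hpq, hsym _ (x c)]
    ring
  simp_rw [hint]
  -- factorise the double integral
  have hG₁ : Measurable fun y => k (x c) y * f y * w y := (hk.of_uncurry_left.mul hf).mul hw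
  have hG₂ : Measurable fun y' => k (x (c + n)) y' * w y' * g y' :=
    (hk.of_uncurry_left.mul hw).mul hg
  have hinner : ∀ y', ∫⁻ y, Φ x * B c n x * (k (x (c + n)) y' * w y' * g y') *
      (k (x c) y * f y * w y) ∂ν =
      Φ x * B c n x * (k (x (c + n)) y' * w y' * g y') * ∫⁻ y, k (x c) y * f y * w y ∂ν :=
    fun y' => lintegral_const_mul _ hG₁
  simp_rw [hinner]
  rw [lintegral_mul_const _ (hG₂.const_mul _), lintegral_const_mul _ hG₂, hT f (x c),
    hT g (x (c + n))]
  have hcomm : ∫⁻ y', k (x (c + n)) y' * w y' * g y' ∂ν = ∫⁻ y', k (x (c + n)) y' * g y' * w y' ∂ν :=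
    lintegral_congr fun y' => by ring
  rw [hcomm]
  ring

/-- **Two-sided peeling (transfer-operator form of window integrals).** Let `Φ` be a measurable
observable read on the window `W = {a, …, a+m}`, `k` symmetric, `f, g` measurable. Then for every
`i` and every boundary condition `η`,
`∫⋯∫⁻_{a-i, …, a+m+i} Φ · B (a-i) (m+2i) · f(σ_{a-i}) · g(σ_{a+m+i})
   = ∫⋯∫⁻_W Φ · B a m · (T^i f)(σ_a) · (T^i g)(σ_{a+m})`:
integrating out the two outermost sites turns the factors `f`, `g` attached to them into `T f`,
`T g` attached to the next sites (Markov property of nearest-neighbour weights; Georgii 2011,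
§10.1–11.1). [cite: Georgii2011, Thm 10.25 and §11.1] -/
theorem lmarginal_Icc_peel_iterate [SigmaFinite ν] (hk : Measurable (uncurry k)) (hw : Measurable w)
    (hsym : ∀ z y, k z y = k y z)
    (hB : ∀ a n σ, B a n σ = (∏ j ∈ Finset.range n, k (σ (a + j)) (σ (a + j + 1))) *
      ∏ j ∈ Finset.range (n + 1), w (σ (a + j)))
    (hT : ∀ f z, T f z = ∫⁻ y, k z y * f y * w y ∂ν)
    {a : ℤ} {m : ℕ} {Φ : (ℤ → S) → ℝ≥0∞} (hΦm : Measurable Φ)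
    (hΦd : DependsOn Φ (↑(Finset.Icc a (a + m)) : Set ℤ))
    {f g : S → ℝ≥0∞} (hf : Measurable f) (hg : Measurable g) (i : ℕ) (η : ℤ → S) :
    (∫⋯∫⁻_Finset.Icc (a - i) (a + m + i),
        (fun σ => Φ σ * B (a - i) (m + 2 * i) σ * f (σ (a - i)) * g (σ (a + m + i)))
        ∂fun _ : ℤ => ν) η =
      (∫⋯∫⁻_Finset.Icc a (a + m),
        (fun σ => Φ σ * B a m σ * (T^[i] f) (σ a) * (T^[i] g) (σ (a + m)))
        ∂fun _ : ℤ => ν) η := by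
  classical
  induction i generalizing f g η with
  | zero =>
    simp only [Nat.cast_zero, sub_zero, add_zero, mul_zero, Function.iterate_zero, id_eq]
  | succ i ih =>
    -- the two new sites `a - i - 1`, `a + m + i + 1`
    have hqI : a + m + i + 1 ∉ Finset.Icc (a - i) (a + m + i) := by
      simp only [Finset.mem_Icc]; omega
    have hpqI : a - i - 1 ∉ insert (a + m + i + 1) (Finset.Icc (a - i) (a + m + i)) := by
      simp only [Finset.mem_insert, Finset.mem_Icc]; omega
    have hset : Finset.Icc (a - ((i + 1 : ℕ) : ℤ)) (a + m + ((i + 1 : ℕ) : ℤ)) =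
        insert (a - i - 1) (insert (a + m + i + 1) (Finset.Icc (a - i) (a + m + i))) := by
      ext x
      simp only [Finset.mem_Icc, Finset.mem_insert]
      push_cast
      omega
    -- the integrand, normalised
    obtain ⟨F, hFdef⟩ : ∃ F : (ℤ → S) → ℝ≥0∞, ∀ σ, F σ =
        Φ σ * B (a - i - 1) (m + 2 * i + 2) σ * f (σ (a - i - 1)) * g (σ (a + m + i + 1)) :=
      ⟨_, fun _ => rfl⟩
    have hF : (fun σ : ℤ → S => Φ σ * B (a - ((i + 1 : ℕ) : ℤ)) (m + 2 * (i + 1)) σ *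
        f (σ (a - ((i + 1 : ℕ) : ℤ))) * g (σ (a + m + ((i + 1 : ℕ) : ℤ)))) = F := by
      funext σ
      have h1 : a - ((i + 1 : ℕ) : ℤ) = a - i - 1 := by push_cast; ring
      have h2 : a + m + ((i + 1 : ℕ) : ℤ) = a + m + i + 1 := by push_cast; ring
      have h3 : m + 2 * (i + 1) = m + 2 * i + 2 := by ring
      rw [hFdef, h1, h2, h3]
    have hFm : Measurable F := by
      have h : F = fun σ => Φ σ * B (a - i - 1) (m + 2 * i + 2) σ * f (σ (a - i - 1)) *
          g (σ (a + m + i + 1)) := funext hFdef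
      rw [h]
      exact ((hΦm.mul (measurable_B hk hw hB _ _)).mul (hf.comp (measurable_pi_apply _))).mul
        (hg.comp (measurable_pi_apply _))
    have hF₁m' : Measurable fun p : (ℤ → S) × S => F (update p.1 (a - i - 1) p.2) :=
      hFm.comp measurable_update'
    have hF₁m : Measurable fun x : ℤ → S => ∫⁻ y, F (update x (a - i - 1) y) ∂ν :=
      hF₁m'.lintegral_prod_right'
    rw [hF, hset, lmarginal_insert' _ hFm hpqI, lmarginal_insert' _ hF₁m hqI]
    -- evaluate the inner double integral
    have hcn : (a - i : ℤ) + ((m + 2 * i : ℕ) : ℤ) = a + m + i := by push_cast; ring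
    have hΦd' : DependsOn Φ (↑(Finset.Icc (a - i) ((a - i : ℤ) + ((m + 2 * i : ℕ) : ℤ))) : Set ℤ) := by
      rw [hcn]
      refine hΦd.mono ?_
      simp only [Finset.coe_Icc]
      exact Set.Icc_subset_Icc (by omega) (by omega)
    have hfun : (fun x : ℤ → S => ∫⁻ y', ∫⁻ y, F (update (update x (a + m + i + 1) y')
        (a - i - 1) y) ∂ν ∂ν) =
        fun x => Φ x * B (a - i) (m + 2 * i) x * (T f) (x (a - i)) * (T g) (x (a + m + i)) := by
      funext x
      have hkey := lintegral_lintegral_pad (ν := ν) hk hw hsym hB hT hΦd' hf hg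
        (p := a - i - 1) (q := a + m + i + 1) (by ring) (by rw [hcn]) x
      rw [hcn] at hkey
      rw [← hkey]
      refine lintegral_congr fun y' => lintegral_congr fun y => ?_
      rw [hFdef]
    rw [hfun, ih (measurable_T hk hw hT hf) (measurable_T hk hw hT hg) η]
    simp only [Function.iterate_succ_apply]

/-- **The padded window as a double integral against the matrix element.** For an observable `Φ`
read on `W = {a, …, a+m}`, measurable `F, G` and any `η`,
`∫⋯∫⁻_{a-1,…,a+m+1} Φ · B (a-1) (m+2) · F(σ_{a-1}) · G(σ_{a+m+1}) (η)
   = ∫ F(y) w(y) [∫⋯∫⁻_W Φ · B a m · k(y, σ_a) · k(σ_{a+m}, y') (η)] G(y') w(y') dν(y) dν(y')`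
— the two extra spins become explicit integration variables coupled to the ends of the window
(Georgii 2011, §10.1). [cite: Georgii2011, Thm 10.25 and §11.1] -/
theorem lmarginal_Icc_pad_one [SigmaFinite ν] (hk : Measurable (uncurry k)) (hw : Measurable w)
    (hB : ∀ a n σ, B a n σ = (∏ j ∈ Finset.range n, k (σ (a + j)) (σ (a + j + 1))) *
      ∏ j ∈ Finset.range (n + 1), w (σ (a + j)))
    {a : ℤ} {m : ℕ} {Φ : (ℤ → S) → ℝ≥0∞} (hΦm : Measurable Φ)
    (hΦd : DependsOn Φ (↑(Finset.Icc a (a + m)) : Set ℤ))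
    {F G : S → ℝ≥0∞} (hF : Measurable F) (hG : Measurable G) (η : ℤ → S) :
    (∫⋯∫⁻_Finset.Icc (a - 1) (a + m + 1),
        (fun σ => Φ σ * B (a - 1) (m + 2) σ * F (σ (a - 1)) * G (σ (a + m + 1)))
        ∂fun _ : ℤ => ν) η =
      ∫⁻ y, ∫⁻ y', F y * w y *
        (∫⋯∫⁻_Finset.Icc a (a + m),
          (fun σ => Φ σ * B a m σ * k y (σ a) * k (σ (a + m)) y') ∂fun _ : ℤ => ν) η *
        (G y' * w y') ∂ν ∂ν := by
  classical
  have hpq : a - 1 ≠ a + m + 1 := by omega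
  have hpW : a - 1 ∉ Finset.Icc a (a + m) := by simp only [Finset.mem_Icc]; omega
  have hqW : a + m + 1 ∉ Finset.Icc a (a + m) := by simp only [Finset.mem_Icc]; omega
  have hpqW : a - 1 ∉ insert (a + m + 1) (Finset.Icc a (a + m)) := by
    rw [Finset.mem_insert, not_or]; exact ⟨hpq, hpW⟩
  have hset : Finset.Icc (a - 1) (a + m + 1) = insert (a - 1) (insert (a + m + 1)
      (Finset.Icc a (a + m))) := by
    ext x
    simp only [Finset.mem_Icc, Finset.mem_insert]
    omega
  obtain ⟨Fσ, hFσ⟩ : ∃ Fσ : (ℤ → S) → ℝ≥0∞, ∀ σ, Fσ σ =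
      Φ σ * B (a - 1) (m + 2) σ * F (σ (a - 1)) * G (σ (a + m + 1)) := ⟨_, fun _ => rfl⟩
  have hgoal : (fun σ : ℤ → S => Φ σ * B (a - 1) (m + 2) σ * F (σ (a - 1)) * G (σ (a + m + 1))) =
      Fσ := funext fun σ => (hFσ σ).symm
  have hFσm : Measurable Fσ := by
    rw [← hgoal]
    exact ((hΦm.mul (measurable_B hk hw hB _ _)).mul (hF.comp (measurable_pi_apply _))).mul
      (hG.comp (measurable_pi_apply _))
  rw [hgoal, hset, lmarginal_insert _ hFσm hpqW]
  refine lintegral_congr fun y => ?_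
  rw [lmarginal_insert _ hFσm hqW]
  refine lintegral_congr fun y' => ?_
  -- the configuration with the two extra spins frozen
  obtain ⟨x, hx⟩ : ∃ x : ℤ → S, x = update (update η (a - 1) y) (a + m + 1) y' := ⟨_, rfl⟩
  rw [← hx]
  have hxp : x (a - 1) = y := by rw [hx, update_of_ne hpq, update_self]
  have hxq : x (a + m + 1) = y' := by rw [hx, update_self]
  -- pull the frozen factors out of the window integral
  have hfib : ∀ ζ : ↥(Finset.Icc a (a + m)) → S,
      Fσ (updateFinset x (Finset.Icc a (a + m)) ζ) =
        (fun σ => Φ σ * B a m σ * k y (σ a) * k (σ (a + m)) y' * (F y * w y * (G y' * w y')))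
          (updateFinset x (Finset.Icc a (a + m)) ζ) := by
    intro ζ
    have hσp : updateFinset x (Finset.Icc a (a + m)) ζ (a - 1) = y := by
      simp [updateFinset, hpW, hxp]
    have hσq : updateFinset x (Finset.Icc a (a + m)) ζ (a + m + 1) = y' := by
      simp [updateFinset, hqW, hxq]
    rw [hFσ]
    dsimp only
    rw [B_pad_one hB a m, hσp, hσq]
    ring
  rw [lmarginal_congr_of_forall_updateFinset
      (g := fun σ => Φ σ * B a m σ * k y (σ a) * k (σ (a + m)) y' * (F y * w y * (G y' * w y')))
      _ x hfib,
    lmarginal_mul_const_right _ ?_ _ x]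
  · have hdep : DependsOn (fun σ : ℤ → S => Φ σ * B a m σ * k y (σ a) * k (σ (a + m)) y')
        (↑(Finset.Icc a (a + m)) : Set ℤ) := by
      intro σ σ' h
      have ha : σ a = σ' a := h a (by simp)
      have hb : σ (a + m) = σ' (a + m) := h (a + m) (by simp)
      dsimp only
      rw [hΦd h, dependsOn_B hB a m h, ha, hb]
    rw [lmarginal_eq_of_dependsOn (ν := ν) hdep x η]
    ring
  · exact ((hΦm.mul (measurable_B hk hw hB _ _)).mul
      (hk.of_uncurry_left.comp (measurable_pi_apply a))).mul
      ((hk.of_uncurry_right (y := y')).comp (measurable_pi_apply (a + (m : ℤ))))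

end Peel

end Literature.Probability.LatticeModels

end
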